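import Literature.RingTheory.MvPowerSeries.MonoidPowerSeries
import HarnessLib

/-!
# Kato's division lemma for completed monoid algebras (Toric singularities, Lemma (3.5))

`Literature/RingTheory/MvPowerSeries/MonoidPowerSeriesDivision.lean`. K. Kato, *Toric
singularities*, Amer. J. Math. 116 (1994), Lemma (3.5): "Let `R` be a ring, `π` a non-zero-divisor
of `R`, `P` a finitely generated integral monoid with `P^× = {1}`, `θ ∈ R[[P]]` with
`θ ≡ π mod (P ∖ {1})`, `Q` a finitely generated integral monoid with `Q^× = {1}` and `P → Q` an
injective homomorphism. Then `R[[P]]/(θ) → R[[Q]]/(θ)` is injective." In the rendering of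
`MonoidPowerSeries.lean` (`R⟦P⟧ = monoidPowerSeries R P ⊆ R⟦x_s : s ∈ σ⟧` the series supported on
a submonoid `P ⊆ ℕ^{(σ)}`), we PROVE the following form, in which the larger monoid `Q` plays no
role (take `Q = ℕ^{(σ)}`, the strongest case): if `θ ∈ R⟦P⟧` has constant coefficient a
non-zero-divisor of `R`, then for every series `h ∈ R⟦x⟧`,
`θ · h ∈ R⟦P⟧ ⟹ h ∈ R⟦P⟧` (`monoidPowerSeries.mem_of_mul_mem`), i.e.
`θ·R⟦x⟧ ∩ R⟦P⟧ = θ·R⟦P⟧` (`monoidPowerSeries.mul_mem_iff`, `comap_span_singleton`), i.e. the map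
`R⟦P⟧/θR⟦P⟧ → R⟦x⟧/θR⟦x⟧` is injective (`monoidPowerSeries.quotientMap_injective`).
Kato's proof: a coefficient of `h` outside `P` of least degree `a₀` would give
`(θh)_{a₀} = π·h_{a₀} ≠ 0`, although `a₀ ∉ P`.

References: [Kato1994] K. Kato, Toric singularities, Amer. J. Math. 116 (1994), Lemma (3.5)
(p. 1078–1079).
-/

noncomputable section

open MvPowerSeries

namespace Literature.RingTheory.MvPowerSeries

namespace monoidPowerSeries

universe u v

variable {σ : Type u} {R : Type v} [CommRing R] {P : AddSubmonoid (σ →₀ ℕ)}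

/-- **Kato 1994, Lemma (3.5)** (division form). Let `θ ∈ R⟦P⟧` have constant coefficient a
non-zero-divisor of `R`. If `h ∈ R⟦x⟧` and `θ · h` is supported on `P`, then `h` is supported on
`P`. (Kato: for an injection `P → Q` of sharp fine monoids and `θ ≡ π mod (P ∖ {1})` with `π` a
non-zero-divisor, `R[[P]]/(θ) → R[[Q]]/(θ)` is injective; here `Q = ℕ^{(σ)}`.)
[cite: Kato1994, Lemma (3.5)] -/
theorem mem_of_mul_mem {θ : MvPowerSeries σ R} (hθ : θ ∈ monoidPowerSeries R P)
    (hπ : MvPowerSeries.constantCoeff θ ∈ nonZeroDivisors R) {h : MvPowerSeries σ R}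
    (hθh : θ * h ∈ monoidPowerSeries R P) : h ∈ monoidPowerSeries R P := by
  classical
  -- strong induction on the degree of an exponent outside `P`
  suffices H : ∀ n : ℕ, ∀ a : σ →₀ ℕ, a.degree = n → a ∉ P → MvPowerSeries.coeff a h = 0 from
    fun a ha => H _ a rfl ha
  intro n
  induction n using Nat.strong_induction_on with
  | _ n ih =>
    intro a han haP
    -- the coefficient of `θ h` at `a` vanishes since `a ∉ P`
    have hzero : MvPowerSeries.coeff a (θ * h) = 0 := hθh a haP
    rw [MvPowerSeries.coeff_mul, Finset.sum_eq_single (0, a)] at hzero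
    · -- the surviving term is `π · h_a`
      rw [MvPowerSeries.coeff_zero_eq_constantCoeff] at hzero
      exact (mul_left_mem_nonZeroDivisors_eq_zero_iff hπ).1 hzero
    · rintro ⟨b, c⟩ hbc hne
      rw [Finset.HasAntidiagonal.mem_antidiagonal] at hbc
      dsimp only at hbc ⊢
      by_cases hb0 : b = 0
      · subst hb0
        rw [zero_add] at hbc
        subst hbc
        exact (hne rfl).elim
      by_cases hbP : b ∈ P
      · -- then `c ∉ P` (else `a = b + c ∈ P`) and `deg c < deg a`, so `h_c = 0` by induction
        have hcP : c ∉ P := fun hcP => haP (hbc ▸ P.add_mem hbP hcP)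
        have hdeg : c.degree < n := by
          rw [← han, ← hbc, map_add]
          have : 0 < b.degree :=
            Nat.pos_of_ne_zero fun h0 => hb0 ((Finsupp.degree_eq_zero_iff b).1 h0)
          omega
        rw [ih _ hdeg c rfl hcP, mul_zero]
      · rw [hθ b hbP, zero_mul]
    · intro hmem
      exact (hmem (Finset.HasAntidiagonal.mem_antidiagonal.2 (zero_add a))).elim

/-- **Kato 1994, Lemma (3.5)** (ideal form): for `θ ∈ R⟦P⟧` with constant coefficient a
non-zero-divisor, a multiple `θ h` (`h ∈ R⟦x⟧`) lies in `R⟦P⟧` iff `h ∈ R⟦P⟧`; that is,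
`θR⟦x⟧ ∩ R⟦P⟧ = θR⟦P⟧`. [cite: Kato1994, Lemma (3.5)] -/
theorem mul_mem_iff {θ : MvPowerSeries σ R} (hθ : θ ∈ monoidPowerSeries R P)
    (hπ : MvPowerSeries.constantCoeff θ ∈ nonZeroDivisors R) (h : MvPowerSeries σ R) :
    θ * h ∈ monoidPowerSeries R P ↔ h ∈ monoidPowerSeries R P :=
  ⟨mem_of_mul_mem hθ hπ, fun hh => (monoidPowerSeries R P).mul_mem hθ hh⟩

/-- **Kato 1994, Lemma (3.5)** (ideal-contraction form, = injectivity of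
`R⟦P⟧/θR⟦P⟧ → R⟦x⟧/θR⟦x⟧`): for `θ ∈ R⟦P⟧` with constant coefficient a non-zero-divisor of `R`,
the principal ideal `θ·R⟦x⟧` contracts to the principal ideal `θ·R⟦P⟧` along the inclusion
`R⟦P⟧ ⊆ R⟦x⟧`. [cite: Kato1994, Lemma (3.5)] -/
theorem comap_span_singleton (θ : monoidPowerSeries R P)
    (hπ : MvPowerSeries.constantCoeff (θ : MvPowerSeries σ R) ∈ nonZeroDivisors R) :
    (Ideal.span {(θ : MvPowerSeries σ R)}).comap (monoidPowerSeries R P).val.toRingHom =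
      Ideal.span {θ} := by
  refine le_antisymm ?_ ?_
  · intro f hf
    rw [Ideal.mem_comap, Ideal.mem_span_singleton] at hf
    obtain ⟨h, hh⟩ := hf
    have hval : ((monoidPowerSeries R P).val.toRingHom f : MvPowerSeries σ R) =
        (f : MvPowerSeries σ R) := rfl
    rw [hval] at hh
    have hhP : h ∈ monoidPowerSeries R P :=
      mem_of_mul_mem θ.2 hπ (by rw [← hh]; exact f.2)
    exact Ideal.mem_span_singleton.2 ⟨⟨h, hhP⟩, Subtype.ext hh⟩
  · rw [Ideal.span_le, Set.singleton_subset_iff]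
    exact Ideal.mem_comap.2 (Ideal.subset_span rfl)

/-- Hence the induced ring map `R⟦P⟧/θR⟦P⟧ → R⟦x⟧/θR⟦x⟧` is injective (Kato's formulation).
[cite: Kato1994, Lemma (3.5)] -/
theorem quotientMap_injective (θ : monoidPowerSeries R P)
    (hπ : MvPowerSeries.constantCoeff (θ : MvPowerSeries σ R) ∈ nonZeroDivisors R)
    (hle : Ideal.span {θ} ≤
      (Ideal.span {(θ : MvPowerSeries σ R)}).comap (monoidPowerSeries R P).val.toRingHom) :
    Function.Injective (Ideal.quotientMap (Ideal.span {(θ : MvPowerSeries σ R)})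
      (monoidPowerSeries R P).val.toRingHom hle) :=
  Ideal.quotientMap_injective' (le_of_eq (comap_span_singleton θ hπ))

end monoidPowerSeries

end Literature.RingTheory.MvPowerSeries
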